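import Summits.BirchSwinnertonDyer.BirchSwinnertonDyer.Theorems.GoldfeldAllTwistsTwoConverseTwinBirchLemmaKrizLi7Twists
import Summits.BirchSwinnertonDyer.BirchSwinnertonDyer.Theorems.PrintCFramBottomClassIndexLawFiveLeBernoulliKummerDictionary
import HarnessLib

set_option linter.dupNamespace false -- namespace `…BirchSwinnertonDyer.BirchSwinnertonDyer…` is the cell's (D-0017 nested layout)
set_option autoImplicit false

/-!
# Crux `PrintCFram.BottomClassIndexLawFiveLe` (stmt-BirchSwinnertonDyer-20372), line `eisenstein-resource-bdp-line` (registry v25):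
# THE GENUS-INTERNAL HEEGNER FIELD AT `p = 7` — every level-`49` Heegner point of `X₀(49)` over a `7`-REGULAR imaginary
# quadratic field `K` (Heegner for `49`) has infinite order, from Kriz–Li 2019 Thm. 1.20 and the KUMMER CONGRUENCE
# `B_{1,ε_Kω⁴} ≡ B_{5,ε_K}/5 (mod 7)` — no certificate, no auxiliary field
# (cell `bsd-print-cfram`, width seat `bsd-line-cfram-p1-w6` g8; THEOREMS ONLY, `--supports` 20372; BSD is not proved by any of this)

HONEST FRAMING. Nothing here is a statement about BSD; no stub of the registered skeleton is closed and the registry is unchanged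
(registration is the LEAD's). This file is PRICE P1 of the critic's verdict V#146 (idea-crit-10 g5, 2026-08-29) on the crux idea
«genus-internal-heegner-fields» (ideator bsd-idea-7 g19, `Cruxes/BottomClassIndexLawFiveLe/Ideas/genus-internal-heegner-fields.md`):
the entry lemma of the branch that takes the `p = 7`, `χ_{e*}(7) = +1` REGULAR classes of the research stub `stub_seedOffExc` WITHOUT
any seed search. For a class datum `(p, m, χ = χ_{e*}, k) = (7, |e*|, χ_{e*}, 2)` the registry's regularity hypothesis is
`7 ∤ B_{p−k,χ}/(p−k) = B_{5,χ_{e*}}/5`; when `(e*/7) = +1` the twisting field `K = ℚ(√e*)` is ITSELF a Heegner field for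
`X₀(49) = cm7` (`7` split), and Kriz–Li's Bernoulli pair for `(cm7, 7, ψ = ω², K)` is `B_{1,ψ₀⁻¹ε_K}·B_{1,ψ₀ω⁻¹} = B_{1,ε_Kω⁴}·B_{1,ω}`
with `B_{1,ω}` a `7`-unit always (cell bsd-cm, `RouteU.norm_bernoulliOnePrim_teichmuller_seven`) and — the point of this file —
`B_{1,ε_Kω⁴} ≡ B_{5,ε_K}/5 (mod 7)` by the χ-twisted Kummer congruence (Literature `CharacterTwist.norm_generalizedBernoulli_one_sub_div_lt_one`,
read on the primitive character through w8 g3's `KummerDictionary.norm_bernoulliOnePrim_le_inv_iff_of_values`). So the Bernoulli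
hypothesis of Thm. 1.20 IS the class's regularity, and the theorem gives `(7/7)·log_{ω_E} P_K ≢ 0 (mod 7)`, hence `P_K ∉ cm7(K)_tors`.

Relation to cell bsd-goldfeld's file `…GoldfeldAllTwistsTwoConverseTwinBirchLemmaKrizLi7` (seat s1p-c301 gen 5), whose §0–§1
(the characters for `ψ = ω²`, the `hss` binder of `cm7`, the shapes of the two Bernoulli characters, `‖B_{1,ω}‖₇ = 1`) are imported
and used BY NAME: there, T1 `GoldfeldGoodTwists.not_isOfFinAddOrder_heegnerPoint_cm7_of_thm120` treats `d_K = −4q` (`q` prime) and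
discharges `7 ∤ B_{1,ε_{−4q}ω⁴}` by a per-`q` kernel CERTIFICATE (sums of length `28q`); the sequels treat `−8q` and two-prime
discriminants the same way. Here `K` is ANY imaginary quadratic field satisfying the Heegner hypothesis for `49`, and the
hypothesis is the class-level regularity `7 ∤ B_{5,χ}/5` for any primitive `χ` (level prime to `7`) agreeing with `ε_K` at almost all
primes — the currency of the cfram registry (`stub_seedOffExc`'s binder `¬ ‖((p − k : ℕ) : ℚ_[p])⁻¹ * generalizedBernoulli (p − k) χ‖ ≤ p⁻¹`).

## Contents (THEOREMS ONLY; no `def`, no instance, no named fact; every published input is a cite-tagged binder BY NAME)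

* §1 `bernoulliCharOne_teichmuller_sq_apply_natCast`: the values `(ψ₀⁻¹ε_K)(b) = ε_K(b)·ω(b)⁴` of Thm. 1.20's first Bernoulli character
  for `ψ = ω²` at every `b ∈ ℕ`.
* §2 `norm_bernoulliOnePrim_bernoulliCharOne_le_inv_iff` (**`‖B_{1,(ε_Kω⁴)~}‖₇ ≤ 7⁻¹ ⟺ ‖B_{5,χ}/5‖₇ ≤ 7⁻¹`**) and
  `bernoulli_hypothesis_cm7_of_regular` (Thm. 1.20's Bernoulli hypothesis for `(cm7, 7, ω², K)` from regularity).
* §3 **`not_isOfFinAddOrder_heegnerPoint_cm7_of_regular`** (the K-GENERAL non-torsion theorem, `χ`-currency with a values bridge to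
  `ε_K`), `…_of_regular_kronecker` (`χ := ε_K`), `…_of_regular_classDatum` (the registry's spelling `(7 − 2 : ℕ)` of the index).
* §4 the `L`-value reading through bsd-goldfeld's Gross–Zagier dictionary at level `49` (named-fact binders BY NAME, as there):
  `analyticRankEK_cm7_eq_one_of_regular` (`ord_{s=1} L(X₀(49)/K, s) = 1`) and `analyticRank_twist_discr_eq_one_of_regular{,'}`
  (`ord_{s=1} L(W, s) = 1` for every model `W` of `X₀(49)^{(d_K)}` — the cfram class member `A(7)^{(e*)}` when `K = ℚ(√e*)`):
  the `χ_{e*}(7) = +1` regular classes ARE analytically rank one (the critic's «LIVE» reading, V#146 (i)), by print.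

What this does NOT do: it proves no `BSD_p` statement; §4's analytic rank is CONDITIONAL on the same named facts as bsd-goldfeld's
file 4b (KL19 Thm. 1.20, Modularity, Gross–Zagier, Heegner rationality, Coates–Li–Tian–Zhai Thm. 1.2); the downstream display (E/K = cm7 × cm7^{(d_K)},
Gross–Zagier at `N = 49`, Manin, the rank-`0` `BSD₇(49a1)`, the regular-member Selmer count) is the branch's remaining work and is not
touched here. beyond-print theorem: NO (Kriz–Li Thm. 1.20 + Kummer 1851 / Washington Ch. 5 bookkeeping; the combination «Heegner field
= twisting field, regularity = Bernoulli hypothesis» is the ideator's card, checked by the critic desk).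

References: D. Kriz, C. Li, Forum Math. Sigma 7 (2019) e15, Thm. 1.20 (= Thm. 7.1), Rem. 1.21 [KrizLi2019]; L. Washington,
*Cyclotomic Fields*, §5.1, Thm. 5.11, Cor. 5.13 [Washington1997]; S. Lang, *Cyclotomic Fields I and II*, Ch. 2 §2 Thm. 2.5
[LangCyclotomic1990]; B. Gross, in *L-functions and Arithmetic* (1991) §1 [GrossLMS1991]; J. Silverman, AEC IV.6.4, VII.6.3
[SilvermanAEC2009]; critic verdict V#146/V#146b (run/shared/lean/pub/ladder-directors/REQUESTS.md, 2026-08-29T05:26:28Z / 05:37:55Z).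
-/

noncomputable section

open scoped Classical

open WeierstrassCurve NumberField DirichletCharacter
open Literature.NumberTheory Literature.NumberTheory.EllipticCurves
  Literature.NumberTheory.EllipticCurves.ModularForms
open Literature.NumberTheory.EllipticCurves.KrizLi2019 Literature.NumberTheory.LFunctions
open Literature.NumberTheory.Congruences
open Summit.BirchSwinnertonDyer.Rank1Residual
open Summit.BirchSwinnertonDyer.Rank1Residual.X12.O11.RouteU
open Summit.BirchSwinnertonDyer.BirchSwinnertonDyer.Theorems.GoldfeldGoodTwists

namespace Summit.BirchSwinnertonDyer.BirchSwinnertonDyer.Theorems.PrintCFram.GenusInternal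

open Summit.BirchSwinnertonDyer.BirchSwinnertonDyer.Theorems.PrintCFram

/-! ## §1 Values of Thm. 1.20's first Bernoulli character for `ψ = ω²` -/

/-- **`(ψ₀⁻¹ε_K)(b) = ε_K(b)·ω(b)⁴` at every `b ∈ ℕ`** for `ψ = ω²` (even, so `ψ₀ = ψ`, `ψ⁻¹ = ω⁴`) and any `ε` mod `d`: the
character `bernoulliCharOne (ω²) ε = ε↑·(ω⁴)↑` of level `7·d` (bsd-goldfeld's `bernoulliCharOne_teichmuller_sq`) evaluated through
`CharacterTwist.changeLevel_mul_changeLevel_apply_natCast` (both sides vanish off the units).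
[cite: KrizLi2019, Thm. 1.20 (p. 8, the Bernoulli hypothesis) and §1.5 (p. 7, ψ₀)] [cite: Washington1997, §5.1] -/
theorem bernoulliCharOne_teichmuller_sq_apply_natCast (ω : DirichletCharacter ℚ_[7] 7) {d : ℕ}
    (ε : DirichletCharacter ℚ_[7] d) (b : ℕ) :
    bernoulliCharOne (ω ^ 2) ε (b : ZMod (7 * d)) = ε (b : ZMod d) * ω (b : ZMod 7) ^ 4 := by
  rw [bernoulliCharOne_teichmuller_sq, mul_comm (changeLevel (dvd_mul_left d 7) ε),
    CharacterTwist.changeLevel_mul_changeLevel_apply_natCast, MulChar.pow_apply' _ (by norm_num), mul_comm]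

/-! ## §2 The first Bernoulli factor modulo `7` IS the class regularity: `B_{1,(ε_Kω⁴)~} ≡ B_{5,χ}/5 (mod 7)` -/

/-- **`‖B_{1,(ε_Kω⁴)~}‖₇ ≤ 7⁻¹ ⟺ ‖B_{5,χ}/5‖₇ ≤ 7⁻¹`.** For `ω` Teichmüller mod `7`, `ε` any character mod `d`, and `χ` PRIMITIVE
mod `m` with `m ⊥ 7` agreeing with `ε` at every prime off a finite set (`ℓ ∤ N₀`): the `7`-divisibility of Kriz–Li's first
Bernoulli number `B_{1,(ψ₀⁻¹ε_K)~}` for `ψ = ω²` is the `7`-divisibility of `B_{5,χ}/5 = −L(−4, χ)` — the χ-twisted Kummer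
congruence `B_{1,χω⁴} ≡ B_{5,χ}/5 (mod 7)` (`j = 4 = p − 3`) read on the primitive character inducing `ε↑·(ω⁴)↑`
(w8 g3 `KummerDictionary.norm_bernoulliOnePrim_le_inv_iff_of_values`). In the application `χ = ε = ε_K`, or `χ = χ_{e*}` mod
`m = |e*|` for the twisting field `K = ℚ(√e*)`. [cite: Washington1997, Thm. 5.11 and Cor. 5.13] [cite: LangCyclotomic1990, Ch. 2 §2, Thm. 2.5]
[cite: KrizLi2019, Thm. 1.20 (p. 8)] -/
theorem norm_bernoulliOnePrim_bernoulliCharOne_le_inv_iff (ω : DirichletCharacter ℚ_[7] 7)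
    (hω : IsTeichmullerCharacter ω) {d : ℕ} [NeZero d] (ε : DirichletCharacter ℚ_[7] d) {m : ℕ} [NeZero m]
    (χ : DirichletCharacter ℚ_[7] m) (hχ : χ.IsPrimitive) (hm7 : m.Coprime 7) {N₀ : ℕ} (hN₀ : N₀ ≠ 0)
    (hχε : ∀ ℓ : ℕ, ℓ.Prime → ¬ ℓ ∣ N₀ → χ (ℓ : ZMod m) = ε (ℓ : ZMod d)) :
    ‖bernoulliOnePrim (bernoulliCharOne (ω ^ 2) ε)‖ ≤ (7 : ℝ)⁻¹ ↔
      ‖(5 : ℚ_[7])⁻¹ * generalizedBernoulli 5 χ‖ ≤ (7 : ℝ)⁻¹ := by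
  haveI : Fact (Nat.Prime 7) := ⟨by norm_num⟩
  have h := KummerDictionary.norm_bernoulliOnePrim_le_inv_iff_of_values (p := 7) hm7 χ hχ hω (j := 4)
    (by norm_num) (by norm_num) (bernoulliCharOne (ω ^ 2) ε) hN₀ (fun ℓ hℓ hℓN => by
      rw [bernoulliCharOne_teichmuller_sq_apply_natCast, hχε ℓ hℓ hℓN])
  simpa using h

/-- **The Bernoulli hypothesis of Thm. 1.20 for `(X₀(49), 7, ψ = ω², K)` from the class regularity.** With `ω`, `ε`, `χ`, `N₀`
as in `norm_bernoulliOnePrim_bernoulliCharOne_le_inv_iff`: if `7 ∤ B_{5,χ}/5` then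
`B_{1,ψ₀⁻¹ε} · B_{1,ψ₀ω⁻¹} ≢ 0 (mod 7)` — the second factor is `B_{1,ω}`, a `7`-unit for every Teichmüller `ω`
(bsd-goldfeld `norm_bernoulliOnePrim_bernoulliCharTwo_teichmuller_sq`, from bsd-cm `RouteU.norm_bernoulliOnePrim_teichmuller_seven`).
No certificate, no condition on `d` beyond the values bridge. [cite: KrizLi2019, Thm. 1.20 (p. 8, the Bernoulli hypothesis)]
[cite: Washington1997, §5.1, Thm. 5.11 and Cor. 5.13] -/
theorem bernoulli_hypothesis_cm7_of_regular (ω : DirichletCharacter ℚ_[7] 7) (hω : IsTeichmullerCharacter ω)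
    {d : ℕ} [NeZero d] (ε : DirichletCharacter ℚ_[7] d) {m : ℕ} [NeZero m] (χ : DirichletCharacter ℚ_[7] m)
    (hχ : χ.IsPrimitive) (hm7 : m.Coprime 7) {N₀ : ℕ} (hN₀ : N₀ ≠ 0)
    (hχε : ∀ ℓ : ℕ, ℓ.Prime → ¬ ℓ ∣ N₀ → χ (ℓ : ZMod m) = ε (ℓ : ZMod d))
    (hreg : ¬ ‖(5 : ℚ_[7])⁻¹ * generalizedBernoulli 5 χ‖ ≤ (7 : ℝ)⁻¹) :
    ¬ (‖bernoulliOnePrim (bernoulliCharOne (ω ^ 2) ε) *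
        bernoulliOnePrim (bernoulliCharTwo (ω ^ 2) ε ω)‖ ≤ (7 : ℝ)⁻¹) := by
  haveI : Fact (Nat.Prime 7) := ⟨by norm_num⟩
  rw [norm_mul, norm_bernoulliOnePrim_bernoulliCharTwo_teichmuller_sq ω hω ε, mul_one,
    norm_bernoulliOnePrim_bernoulliCharOne_le_inv_iff ω hω ε χ hχ hm7 hN₀ hχε]
  exact hreg

/-! ## §3 The non-torsion theorem over a `7`-regular Heegner field of `X₀(49)` -/

/-- **P1 (critic V#146). Every level-`49` Heegner point of `X₀(49)` over a `7`-REGULAR imaginary quadratic Heegner field has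
infinite order — from Kriz–Li 2019 Thm. 1.20 at the additive Eisenstein prime `p = 7`, K-GENERAL.** Let `K` be an imaginary
quadratic field satisfying the Heegner hypothesis for `49` (so `7` splits in `K` and `7 ∤ d_K`), `ε_K` its Kronecker character
(mod `|d_K|`, `ℚ₇`-valued), and `χ` ANY primitive character of level `m ⊥ 7` agreeing with `ε_K` at all primes off a finite set
(e.g. `χ = ε_K`, or the class character `χ_{e*}` mod `m = |e*|` of the cfram registry when `K = ℚ(√e*)` is the twisting field);
assume the REGULARITY `7 ∤ B_{5,χ}/5` (`¬ ‖5⁻¹·B_{5,χ}‖₇ ≤ 7⁻¹`; the registry's `reg(e)` at `(p, k) = (7, 2)`). Then, granted the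
named fact `KrizLi2019.thm120_padicLogHeegner_unit_of_bernoulli` (refereed), every `P ∈ cm7(K)` that is a Heegner point of level
`49` (`IsHeegnerPoint 49 cm7 K P`: any parametrisation datum, any Manin constant, any Heegner datum) has infinite order.
Instantiation (bsd-goldfeld T1's, by name): `E = cm7 = 49a1` (globally minimal, `N = 49`, CM), `p = 7` additive — allowed (FMS p. 42,
Rem. 1.21), `ψ = ω²` (primitive of conductor `7`, `E[7]^{ss} = 𝔽₇(ω²) ⊕ 𝔽₇(ω⁵)` in trace form `hss_cm7_teichmuller_sq`), (1) `ψ(7) = 0 ≠ 1`,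
`(ψ⁻¹ω)(7) = 0 ≠ 1`, (2) no multiplicative prime (CM), (3) vacuous (`49a1` good away from `7`), `7` split ⇒ a degree-one prime `𝔭 ∣ 7`
and `K ↪ K_𝔭 = ℚ₇` (`X11b.embAt`); the Bernoulli pair `B_{1,ε_Kω⁴}·B_{1,ω}` is a `7`-unit by §2 (Kummer congruence + regularity);
conclusion `(7/7)·log_{ω_E} P ≢ 0 (mod 7)` ⇒ `log_{ω_𝓔} P ≠ 0` (`padicLogOmega_ne_zero_of_not_norm_le`) ⇒ `P ∉ E(K)_tors`
(`X11b.R1.logOmega_eq_zero_iff`). CONDITIONAL on the named fact only; nothing about BSD, ranks or Selmer groups.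
[cite: KrizLi2019, Thm. 1.20 (pp. 7–8) = Thm. 7.1 (pp. 42–43), Rem. 1.21 (p. 8)] [cite: Washington1997, §5.1, Thm. 5.11, Cor. 5.13]
[cite: GrossLMS1991, §1 (p. 235, Heegner hypothesis)] [cite: SilvermanAEC2009, IV.6.4 and VII.6.3 (formal logarithm kills exactly the torsion)] -/
theorem not_isOfFinAddOrder_heegnerPoint_cm7_of_regular
    (h120 : thm120_padicLogHeegner_unit_of_bernoulli)
    (K : Type) [Field K] [NumberField K] (hK : IsImaginaryQuadratic K) (hH : SatisfiesHeegnerHypothesis 49 K)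
    (εK : DirichletCharacter ℚ_[7] (NumberField.discr K).natAbs) (hεK : IsKroneckerCharacterOf K εK)
    {m : ℕ} [NeZero m] (χ : DirichletCharacter ℚ_[7] m) (hχ : χ.IsPrimitive) (hm7 : m.Coprime 7)
    {N₀ : ℕ} (hN₀ : N₀ ≠ 0)
    (hχε : ∀ ℓ : ℕ, ℓ.Prime → ¬ ℓ ∣ N₀ → χ (ℓ : ZMod m) = εK (ℓ : ZMod (NumberField.discr K).natAbs))
    (hreg : ¬ ‖(5 : ℚ_[7])⁻¹ * generalizedBernoulli 5 χ‖ ≤ (7 : ℝ)⁻¹)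
    {P : (cm7.baseChange K).toAffine.Point} (hP : IsHeegnerPoint 49 cm7 K P) : ¬ IsOfFinAddOrder P := by
  haveI : Fact (Nat.Prime 7) := ⟨by norm_num⟩
  haveI : NeZero (cm7.conductorNorm ℤ) := ⟨(cm7.conductorNorm_pos_holds).ne'⟩
  haveI : NeZero (NumberField.discr K).natAbs := ⟨Int.natAbs_ne_zero.mpr (NumberField.discr_ne_zero K)⟩
  -- the Heegner hypothesis at level `N(X₀(49))`, `7` split in `K`, the embedding `K ↪ ℚ₇`
  have hH' : SatisfiesHeegnerHypothesis (cm7.conductorNorm ℤ) K := by rw [conductorNorm_cm7]; exact hH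
  have h7K : ((Ideal.span {((7 : ℕ) : ℤ)}).primesOver (𝓞 K)).ncard = 2 := hH 7 (by norm_num) (by norm_num)
  obtain ⟨𝔭, h𝔭, he, hf⟩ := X11b.exists_degreeOnePrime_of_splitsIn K 7 hK.1 h7K
  -- the datum at level `N(X₀(49))`
  obtain ⟨D, H, ι, hPH⟩ := isHeegnerPoint_of_level_eq conductorNorm_cm7.symm hP
  -- the Teichmüller character
  obtain ⟨ω, hω⟩ := exists_isTeichmullerCharacter (p := 7)
  -- Thm. 1.20
  have key := h120 7 (by norm_num) cm7 7 (ω ^ 2) ω (teichmuller_sq_isPrimitive ω hω) hω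
    (hss_cm7_teichmuller_sq ω hω) (teichmuller_sq_apply_seven_ne_one ω)
    (primVal_invMulOmega_teichmuller_sq_seven_ne_one ω hω)
    (not_hasSplitMultiplicativeReductionAtPrime_of_hasCM cm7 hasCM_cm7')
    (fun ℓ hℓ h7 hbad => by
      haveI := Fact.mk hℓ
      exact absurd (hasGoodReductionAtPrime_cm7 ℓ h7) hbad.1)
    D K hK hH' h7K εK hεK H ι (X11b.embAt K 7 𝔭 h𝔭 he hf) P hPH
    (bernoulli_hypothesis_cm7_of_regular ω hω εK χ hχ hm7 hN₀ hχε hreg)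
  have hlog := padicLogOmega_ne_zero_of_not_norm_le key
  exact fun hfin => hlog ((X11b.R1.logOmega_eq_zero_iff cm7 7 (X11b.embAt K 7 𝔭 h𝔭 he hf) P).mpr hfin)

/-- **P1 in Kronecker currency (`χ := ε_K`).** For `K` imaginary quadratic with the Heegner hypothesis for `49` and `ε_K` its
Kronecker character: if `7 ∤ B_{5,ε_K}/5` (the field is `7`-regular in the registry's sense at `(p, k) = (7, 2)`), then —
granted Kriz–Li Thm. 1.20 — every level-`49` Heegner point `P ∈ X₀(49)(K)` has infinite order. (`7 ∤ d_K` is automatic: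
`7 ∣ 49` splits in `K`, `SatisfiesHeegnerHypothesis.not_dvd_discr`; `ε_K` is primitive by `IsKroneckerCharacterOf`.)
[cite: KrizLi2019, Thm. 1.20 (pp. 7–8) and Rem. 1.21 (p. 8)] [cite: Washington1997, Thm. 5.11 and Cor. 5.13]
[cite: GrossLMS1991, §1 (p. 235)] -/
theorem not_isOfFinAddOrder_heegnerPoint_cm7_of_regular_kronecker
    (h120 : thm120_padicLogHeegner_unit_of_bernoulli)
    (K : Type) [Field K] [NumberField K] (hK : IsImaginaryQuadratic K) (hH : SatisfiesHeegnerHypothesis 49 K)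
    (εK : DirichletCharacter ℚ_[7] (NumberField.discr K).natAbs) (hεK : IsKroneckerCharacterOf K εK)
    (hreg : ¬ ‖(5 : ℚ_[7])⁻¹ * generalizedBernoulli 5 εK‖ ≤ (7 : ℝ)⁻¹)
    {P : (cm7.baseChange K).toAffine.Point} (hP : IsHeegnerPoint 49 cm7 K P) : ¬ IsOfFinAddOrder P := by
  haveI : NeZero (NumberField.discr K).natAbs := ⟨Int.natAbs_ne_zero.mpr (NumberField.discr_ne_zero K)⟩
  have h7d : ¬ 7 ∣ (NumberField.discr K).natAbs := by
    rw [← Int.natCast_dvd]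
    exact Literature.SatisfiesHeegnerHypothesis.not_dvd_discr hK.1 hH (by norm_num) (by norm_num)
  have hd7 : (NumberField.discr K).natAbs.Coprime 7 :=
    ((Nat.Prime.coprime_iff_not_dvd (by norm_num)).mpr h7d).symm
  exact not_isOfFinAddOrder_heegnerPoint_cm7_of_regular h120 K hK hH εK hεK εK hεK.1 hd7 one_ne_zero
    (fun _ _ _ => rfl) hreg hP

/-- **P1 in the registry's class-datum currency.** For a cfram class datum at `p = 7` with `k = (7 + 1)/4 = 2` — `χ` primitive
mod `m`, `m ⊥ 7`, regularity written EXACTLY as in `stub_seedOffExc`: `¬ ‖((7 − 2 : ℕ) : ℚ_[7])⁻¹ * generalizedBernoulli (7 − 2) χ‖ ≤ 7⁻¹`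
— and an imaginary quadratic `K` Heegner for `49` whose Kronecker character agrees with `χ` at almost all primes (the twisting field
`ℚ(√e*)` when `χ = χ_{e*}` and `(e*/7) = +1`): every level-`49` Heegner point of `X₀(49)` over `K` has infinite order, granted
Kriz–Li Thm. 1.20. Quadraticity and parity of `χ` are not needed here. [cite: KrizLi2019, Thm. 1.20 (pp. 7–8) and Rem. 1.21 (p. 8)]
[cite: Washington1997, Thm. 5.11 and Cor. 5.13] -/
theorem not_isOfFinAddOrder_heegnerPoint_cm7_of_regular_classDatum
    (h120 : thm120_padicLogHeegner_unit_of_bernoulli)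
    {m : ℕ} [NeZero m] (χ : DirichletCharacter ℚ_[7] m) (hm7 : m.Coprime 7) (hχ : χ.IsPrimitive)
    (hreg : ¬ ‖((7 - 2 : ℕ) : ℚ_[7])⁻¹ * generalizedBernoulli (7 - 2) χ‖ ≤ (7 : ℝ)⁻¹)
    (K : Type) [Field K] [NumberField K] (hK : IsImaginaryQuadratic K) (hH : SatisfiesHeegnerHypothesis 49 K)
    (εK : DirichletCharacter ℚ_[7] (NumberField.discr K).natAbs) (hεK : IsKroneckerCharacterOf K εK)
    {N₀ : ℕ} (hN₀ : N₀ ≠ 0)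
    (hχε : ∀ ℓ : ℕ, ℓ.Prime → ¬ ℓ ∣ N₀ → χ (ℓ : ZMod m) = εK (ℓ : ZMod (NumberField.discr K).natAbs))
    {P : (cm7.baseChange K).toAffine.Point} (hP : IsHeegnerPoint 49 cm7 K P) : ¬ IsOfFinAddOrder P :=
  not_isOfFinAddOrder_heegnerPoint_cm7_of_regular h120 K hK hH εK hεK χ hχ hm7 hN₀ hχε hreg hP

/-! ## §4 The `L`-value reading: the `χ(7) = +1` regular classes are analytically rank one (Gross–Zagier dictionary at level `49`) -/

/-- **`ord_{s=1} L(X₀(49)/K, s) = 1` for every `7`-regular imaginary quadratic Heegner field `K` of `X₀(49)`**, granted KL19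
Thm. 1.20 (`h120`), Modularity (`hnf`), Gross–Zagier (`hGZ`) and Heegner rationality (`hHP`): §3 puts every level-`49` Heegner
point off the torsion and bsd-goldfeld's dictionary `analyticRankEK_cm7_eq_one_of_heegner_nonTorsion` converts. K-general twin of
bsd-goldfeld's `analyticRankEK_cm7_eq_one_of_thm120` (`d_K = −4q` + certificate). [cite: KrizLi2019, Thm. 1.20 (pp. 7–8) and Rem. 1.21]
[cite: GrossZagier1986, Thm. I.(6.3) with V.§2 and I.§7] [cite: Gross1991, (1.1)] -/
theorem analyticRankEK_cm7_eq_one_of_regular (h120 : thm120_padicLogHeegner_unit_of_bernoulli)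
    (hnf : ModularForms.exists_isNewformOf)
    (hGZ : ∀ (N : ℕ) [NeZero N] (W : WeierstrassCurve ℚ) (K : Type) [Field K] [NumberField K],
      gross_zagier N W K)
    (hHP : ∀ (W : WeierstrassCurve ℚ) (K : Type) [Field K] [NumberField K], exists_isHeegnerPoint W K)
    (K : Type) [Field K] [NumberField K] (hK : IsImaginaryQuadratic K) (hH : SatisfiesHeegnerHypothesis 49 K)
    (εK : DirichletCharacter ℚ_[7] (NumberField.discr K).natAbs) (hεK : IsKroneckerCharacterOf K εK)
    (hreg : ¬ ‖(5 : ℚ_[7])⁻¹ * generalizedBernoulli 5 εK‖ ≤ (7 : ℝ)⁻¹) : analyticRankEK cm7 K = 1 :=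
  analyticRankEK_cm7_eq_one_of_heegner_nonTorsion hnf hGZ hHP K hK hH
    (fun _ hP => not_isOfFinAddOrder_heegnerPoint_cm7_of_regular_kronecker h120 K hK hH εK hεK hreg hP)

/-- **`ord_{s=1} L(W, s) = 1` for every elliptic `W = Cd • X₀(49)^{(d_K)}` over a GIVEN `7`-regular Heegner field `K`, from a
Heegner point `P ∈ X₀(49)(K)` in hand (no `hHP`)** — in the cfram branch `K = ℚ(√e*)` with `(e*/7) = +1` and `W` the class member
`A(7)^{(e*)} = 49a1^{(e*)}`: §3 puts `P` off the torsion, Gross–Zagier gives `ord L(X₀(49)/K) = 1`, Artin formalism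
`ord L(X₀(49)/K) = ord L(X₀(49)) + ord L(X₀(49)^{(d_K)})` with `ord L(X₀(49)) = 0` (Coates–Li–Tian–Zhai Thm. 1.2 at `R = 1`, `h12`;
bsd-goldfeld `analyticRankEK_cm7`) and isogeny invariance. K-general twin of bsd-goldfeld's `analyticRank_twist_discr_eq_one_of_thm120`.
[cite: KrizLi2019, Thm. 1.20 (pp. 7–8)] [cite: CoatesLiTianZhai2015, Thm. 1.2 (p. 359, case r = 0)]
[cite: GrossZagier1986, Thm. I.(6.3) and I.§7] -/
theorem analyticRank_twist_discr_eq_one_of_regular (h120 : thm120_padicLogHeegner_unit_of_bernoulli)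
    (hnf : ModularForms.exists_isNewformOf) (h12 : CoatesLiTianZhai2015.thm12_fullBSD_twist)
    (hGZ : ∀ (N : ℕ) [NeZero N] (W : WeierstrassCurve ℚ) (K : Type) [Field K] [NumberField K],
      gross_zagier N W K)
    (K : Type) [Field K] [NumberField K] (hK : IsImaginaryQuadratic K) (hH : SatisfiesHeegnerHypothesis 49 K)
    (εK : DirichletCharacter ℚ_[7] (NumberField.discr K).natAbs) (hεK : IsKroneckerCharacterOf K εK)
    (hreg : ¬ ‖(5 : ℚ_[7])⁻¹ * generalizedBernoulli 5 εK‖ ≤ (7 : ℝ)⁻¹)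
    {P : (cm7.baseChange K).toAffine.Point} (hP : IsHeegnerPoint 49 cm7 K P)
    (W : WeierstrassCurve ℚ) [W.IsElliptic] (Cd : VariableChange ℚ)
    (hW : Cd • cm7.quadraticTwist (NumberField.discr K : ℚ) = W) : W.analyticRank = 1 := by
  haveI : NeZero (cm7.conductorNorm ℤ) := ⟨(cm7.conductorNorm_pos_holds).ne'⟩
  have hmod : hasEntireLFunction_rat := hasEntireLFunction_rat_of_exists_isNewformOf hnf
  have hEK := (analyticRankEK_eq_one_iff_heegner_nonTorsion_of_exists_isNewformOf cm7 49 K (hGZ 49 cm7 K) hnf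
    hK conductorNorm_cm7 hH hP).mpr (not_isOfFinAddOrder_heegnerPoint_cm7_of_regular_kronecker h120 K hK hH εK hεK hreg hP)
  have hd : (NumberField.discr K : ℚ) ≠ 0 := by exact_mod_cast NumberField.discr_ne_zero K
  haveI := cm7.isElliptic_quadraticTwist hd
  have hiso : IsIsogenous W (cm7.quadraticTwist (NumberField.discr K : ℚ)) := isIsogenous_of_smul_eq' hW
  rw [analyticRankEK_cm7 hmod h12 K, ← analyticRank_eq_of_isIsogenous' hiso] at hEK
  exact hEK

/-- **The same with Heegner rationality (`hHP`) in place of a point in hand: `ord_{s=1} L(W, s) = 1` for every elliptic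
`W = Cd • X₀(49)^{(d_K)}`, `K` a `7`-regular Heegner field of `X₀(49)`.** [cite: KrizLi2019, Thm. 1.20 (pp. 7–8)]
[cite: CoatesLiTianZhai2015, Thm. 1.2 (p. 359, case r = 0)] [cite: GrossZagier1986, Thm. I.(6.3) and I.§7] -/
theorem analyticRank_twist_discr_eq_one_of_regular' (h120 : thm120_padicLogHeegner_unit_of_bernoulli)
    (hnf : ModularForms.exists_isNewformOf) (h12 : CoatesLiTianZhai2015.thm12_fullBSD_twist)
    (hGZ : ∀ (N : ℕ) [NeZero N] (W : WeierstrassCurve ℚ) (K : Type) [Field K] [NumberField K],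
      gross_zagier N W K)
    (hHP : ∀ (W : WeierstrassCurve ℚ) (K : Type) [Field K] [NumberField K], exists_isHeegnerPoint W K)
    (K : Type) [Field K] [NumberField K] (hK : IsImaginaryQuadratic K) (hH : SatisfiesHeegnerHypothesis 49 K)
    (εK : DirichletCharacter ℚ_[7] (NumberField.discr K).natAbs) (hεK : IsKroneckerCharacterOf K εK)
    (hreg : ¬ ‖(5 : ℚ_[7])⁻¹ * generalizedBernoulli 5 εK‖ ≤ (7 : ℝ)⁻¹)
    (W : WeierstrassCurve ℚ) [W.IsElliptic] (Cd : VariableChange ℚ)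
    (hW : Cd • cm7.quadraticTwist (NumberField.discr K : ℚ) = W) : W.analyticRank = 1 := by
  have hmod : hasEntireLFunction_rat := hasEntireLFunction_rat_of_exists_isNewformOf hnf
  have hEK := analyticRankEK_cm7_eq_one_of_regular h120 hnf hGZ hHP K hK hH εK hεK hreg
  have hd : (NumberField.discr K : ℚ) ≠ 0 := by exact_mod_cast NumberField.discr_ne_zero K
  haveI := cm7.isElliptic_quadraticTwist hd
  have hiso : IsIsogenous W (cm7.quadraticTwist (NumberField.discr K : ℚ)) := isIsogenous_of_smul_eq' hW
  rw [analyticRankEK_cm7 hmod h12 K, ← analyticRank_eq_of_isIsogenous' hiso] at hEK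
  exact hEK

end Summit.BirchSwinnertonDyer.BirchSwinnertonDyer.Theorems.PrintCFram.GenusInternal

end
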